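import Summits.QuantumAdvantage.QuantumAdvantage.Theorems.CharDialJLinPeel
import Summits.QuantumAdvantage.QuantumAdvantage.Theorems.CharDialSegmentMovesB
import Summits.QuantumAdvantage.QuantumAdvantage.Theorems.CharDialMaskDialA
import HarnessLib

/-!
# CharDial / JLinPeel — dial tower, DEFINITIONS-ONLY module (route `CharDial`, item 32604; lens-6 node g18 §11.6, writer l.1737/l.1750)

The ROUTE-ITEM VOCABULARY of the five-dial tower, re-declared VERBATIM from `Theorems.CharDialTowerA/B/C` (namespace `…JLinPeel.Tower`) in the
fresh namespace `…JLinPeel.TowerDefs`, in a module with NO import path to `Theses.CharDial` (imports: `CharDialJLinPeel` for `JLinData`,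
`CharDialSegmentMovesB` for `SegMove.lowPositions`, `CharDialMaskDialA` for `BlockDial.blk` / `MaskDial.zblk`; `JLinPeel.cubeRate`, whose home
`CharDialRankRate` reaches the route file, is copied as `TowerDefs.cubeRate`).  So the split items of 32604 can be typed BY NAME
(`TowerDefs.LowResidual5Side TowerDefs.dialB`, `TowerDefs.ResidualHigh5Side TowerDefs.dialB`) with item imports `[Theorems.CharDialTowerDefs]`;
the bridges `TowerDefs.X ↔ Tower.X` (all `Iff.rfl`), the closer and the class-inhabitant in this vocabulary are `Theorems.CharDialTowerE`.
Definitions only; 0 theorems; 0 sorry.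
-/

set_option autoImplicit false

namespace Summit.QuantumAdvantage.AdviceFreeQNC0.JLinPeel.TowerDefs

open Finset

variable {n : ℕ}

/-- the hypothesis of `CharDial.WalkHardFJLinOdd`, verbatim: every cut is a `log₂ n`-junta ⊕ ONE `𝔽_p`-linear form. -/
def JLinHyp (p n : ℕ) (y : Fin (n + 1) → (Fin n → Bool) → Bool) : Prop :=
  ∀ g, ∃ J : Finset (Fin n), J.card ≤ Nat.log 2 n ∧ ∃ a : Fin n → ZMod p,
    ∃ h : (Fin n → Bool) → ZMod p → Bool, (∀ u v : Fin n → Bool, (∀ i ∈ J, u i = v i) → ∀ s, h u s = h v s) ∧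
      ∀ u, y g u = h u (∑ i, if u i then a i else 0)

/-- the dial predicate: at least half of the positions have low variation at threshold `B n` (swap-influence mass, tree `SegMove.lowPositions`). -/
def LowVar (B : ℕ → ℕ) (n : ℕ) (y : Fin (n + 1) → (Fin n → Bool) → Bool) : Prop :=
  n ≤ 2 * (SegMove.lowPositions n y (B n)).card

/-- the node's default threshold schedule: four juntas' worth, `B n = 4·(log₂ n + 1)`. -/
def dialB (n : ℕ) : ℕ := 4 * (Nat.log 2 n + 1)

/-- **piece LOW (bounded variation).** `WalkHardFJLinOdd` restricted to strategies on the LOW side of the dial. -/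
def LowSide (B : ℕ → ℕ) : Prop :=
  ∀ (p : ℕ) [Fact p.Prime], 5 ≤ p → ∃ θ : ℝ, θ < 1 ∧ ∃ n₀ : ℕ, ∀ n ≥ n₀, ∀ c : ℕ,
    ∀ y : Fin (n + 1) → (Fin n → Bool) → Bool, JLinHyp p n y → LowVar B n y →
      ((Finset.univ.filter fun u : Fin n → Bool => ringWinU c y u = true).card : ℝ) ≤ θ * (2 : ℝ) ^ n

/-- **piece HIGH (large variation).** `WalkHardFJLinOdd` restricted to strategies on the HIGH side of the dial. -/
def HighSide (B : ℕ → ℕ) : Prop :=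
  ∀ (p : ℕ) [Fact p.Prime], 5 ≤ p → ∃ θ : ℝ, θ < 1 ∧ ∃ n₀ : ℕ, ∀ n ≥ n₀, ∀ c : ℕ,
    ∀ y : Fin (n + 1) → (Fin n → Bool) → Bool, JLinHyp p n y → ¬ LowVar B n y →
      ((Finset.univ.filter fun u : Fin n → Bool => ringWinU c y u = true).card : ℝ) ≤ θ * (2 : ℝ) ^ n

/-- the CUBE-ROOT RATE, verbatim copy of `JLinPeel.cubeRate` (`Theorems.CharDialRankRate`, which this module must not import): the largest `ρ ≤ n`
with `ρ³·(log₂ n)⁵ ≤ n`. -/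
def cubeRate (n : ℕ) : ℕ := Nat.findGreatest (fun ρ => ρ ^ 3 * (Nat.log 2 n) ^ 5 ≤ n) n

variable {p : ℕ}

/-- the RANK DIAL hypothesis on a presentation: the forms of the non-constant cuts lie in a span of dimension `cubeRate n`. -/
def SpanHyp (D : JLinPeel.JLinData p n) : Prop :=
  ∃ A : Fin (cubeRate n) → Fin n → ZMod p,
    ∀ g, ¬ (∀ (u : Fin n → Bool) (s s' : ZMod p), D.h g u s = D.h g u s') →
      ∃ l : Fin (cubeRate n) → ZMod p, D.a g = fun i => ∑ j, l j * A j i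

/-- the SPARSE-FREE-SET DIAL hypothesis on a presentation: some set `S` of `≥ log₂ n` coordinates meets every cut's junta ∪ form-support in
`≤ √#S` points. -/
def SparseHyp (D : JLinPeel.JLinData p n) : Prop :=
  ∃ S : Finset (Fin n), Nat.log 2 n ≤ S.card ∧
    ∀ g, (S.filter fun i => i ∈ D.J g ∨ D.a g i ≠ 0).card ≤ Nat.sqrt S.card

/-- the BLOCK DIAL hypothesis on a presentation (threshold explicit in `n, p`): there are `M ≥ 2^p·((log₂ n + 1)² + 1)` pairwise separated
blocks `[S k, S k + p) ⊆ {0,…,n−1}` on each of which every form `D.a g` is constant. -/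
def BlockHyp (D : JLinPeel.JLinData p n) : Prop :=
  ∃ (M : ℕ) (S : Fin M → ℕ), ((∀ k k' : Fin M, k < k' → S k + p ≤ S k') ∧ (∀ k : Fin M, S k + p ≤ n)) ∧
    2 ^ p * ((Nat.log 2 n + 1) * (Nat.log 2 n + 1) + 1) ≤ M ∧
      ∀ g (k : Fin M) (i i' : Fin n), (S k ≤ i.val ∧ i.val < S k + p) → (S k ≤ i'.val ∧ i'.val < S k + p) → D.a g i = D.a g i'

/-- the NULL DIAL hypothesis on a presentation (threshold explicit in `n`): for some window length `ℓ ≢ 0 (mod 3)` there are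
`M ≥ 2^ℓ·((log₂ n + 1)² + 1)` pairwise separated windows `[S k, S k + ℓ) ⊆ {0,…,n−1}` on each of which every form `D.a g` has ZERO SUM. -/
def NullHyp (D : JLinPeel.JLinData p n) : Prop :=
  ∃ (ℓ M : ℕ) (S : Fin M → ℕ), (ℓ % 3 = 1 ∨ ℓ % 3 = 2) ∧
    ((∀ k k' : Fin M, k < k' → S k + ℓ ≤ S k') ∧ (∀ k : Fin M, S k + ℓ ≤ n)) ∧
    2 ^ ℓ * ((Nat.log 2 n + 1) * (Nat.log 2 n + 1) + 1) ≤ M ∧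
      ∀ g (k : Fin M), ∑ i ∈ Summit.QuantumAdvantage.AdviceFreeQNC0.JLinPeel.BlockDial.blk ℓ S k, D.a g i = 0

/-- the MASK DIAL hypothesis on a presentation (threshold explicit in `n`): for some span length `ℓ`, mask `Z` and mask size `m ≢ 0 (mod 3)` there are
`M ≥ 2^m·((log₂ n + 1)² + 1)` pairwise separated span windows `[S k, S k + ℓ) ⊆ {0,…,n−1}` whose masked blocks all have size `m`, on each of which every
form `D.a g` has ZERO SUM. -/
def MaskHyp (D : JLinPeel.JLinData p n) : Prop :=
  ∃ (ℓ m M : ℕ) (S : Fin M → ℕ) (Z : Finset (Fin n)), (m % 3 = 1 ∨ m % 3 = 2) ∧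
    ((∀ k k' : Fin M, k < k' → S k + ℓ ≤ S k') ∧ (∀ k : Fin M, S k + ℓ ≤ n)) ∧
    (∀ k : Fin M, (MaskDial.zblk ℓ S Z k).card = m) ∧
    2 ^ m * ((Nat.log 2 n + 1) * (Nat.log 2 n + 1) + 1) ≤ M ∧
      ∀ g (k : Fin M), ∑ i ∈ MaskDial.zblk ℓ S Z k, D.a g i = 0

/-- **piece RESIDUAL-HIGH⁵.** `WalkHardFJLinOdd` restricted to HIGH-variation strategies all of whose `log₂ n`-junta ⊕ form presentations escape the
rank dial, the sparse dial, the block dial, the null dial AND the mask dial (the residual of the split of 32604; class INHABITED: `Theorems.CharDialTowerE`). -/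
def ResidualHigh5Side (B : ℕ → ℕ) : Prop :=
  ∀ (p : ℕ) [Fact p.Prime], 5 ≤ p → ∃ θ : ℝ, θ < 1 ∧ ∃ n₀ : ℕ, ∀ n ≥ n₀, ∀ c : ℕ,
    ∀ y : Fin (n + 1) → (Fin n → Bool) → Bool, JLinHyp p n y → ¬ LowVar B n y →
      (∀ D : JLinPeel.JLinData p n, D.strat = y → (∀ g, (D.J g).card ≤ Nat.log 2 n) →
          ¬ SpanHyp D ∧ ¬ SparseHyp D ∧ ¬ BlockHyp D ∧ ¬ NullHyp D ∧ ¬ MaskHyp D) →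
        ((Finset.univ.filter fun u : Fin n → Bool => ringWinU c y u = true).card : ℝ) ≤ θ * (2 : ℝ) ^ n

/-- **piece LOW-RESIDUAL⁵.** the same restriction on the LOW-variation side (the decided-side crux of the split of 32604). -/
def LowResidual5Side (B : ℕ → ℕ) : Prop :=
  ∀ (p : ℕ) [Fact p.Prime], 5 ≤ p → ∃ θ : ℝ, θ < 1 ∧ ∃ n₀ : ℕ, ∀ n ≥ n₀, ∀ c : ℕ,
    ∀ y : Fin (n + 1) → (Fin n → Bool) → Bool, JLinHyp p n y → LowVar B n y →
      (∀ D : JLinPeel.JLinData p n, D.strat = y → (∀ g, (D.J g).card ≤ Nat.log 2 n) →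
          ¬ SpanHyp D ∧ ¬ SparseHyp D ∧ ¬ BlockHyp D ∧ ¬ NullHyp D ∧ ¬ MaskHyp D) →
        ((Finset.univ.filter fun u : Fin n → Bool => ringWinU c y u = true).card : ℝ) ≤ θ * (2 : ℝ) ^ n

/-- **the FIVE-DIAL RESIDUAL of T** (no variation condition). -/
def Residual5Side : Prop :=
  ∀ (p : ℕ) [Fact p.Prime], 5 ≤ p → ∃ θ : ℝ, θ < 1 ∧ ∃ n₀ : ℕ, ∀ n ≥ n₀, ∀ c : ℕ,
    ∀ y : Fin (n + 1) → (Fin n → Bool) → Bool, JLinHyp p n y →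
      (∀ D : JLinPeel.JLinData p n, D.strat = y → (∀ g, (D.J g).card ≤ Nat.log 2 n) →
          ¬ SpanHyp D ∧ ¬ SparseHyp D ∧ ¬ BlockHyp D ∧ ¬ NullHyp D ∧ ¬ MaskHyp D) →
        ((Finset.univ.filter fun u : Fin n → Bool => ringWinU c y u = true).card : ℝ) ≤ θ * (2 : ℝ) ^ n

end Summit.QuantumAdvantage.AdviceFreeQNC0.JLinPeel.TowerDefs
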